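import Literature.Combinatorics.SimpleGraph.HamiltonianLOTCount
import HarnessLib

/-!
# Adjacency in the gadget graph of the `#3SAT → #HamPath` reduction, made explicit

The graph `graph₂ φ` of `HamiltonianLOTCount.lean` is defined by two rounds of gadget substitution.
This file unfolds its adjacency: the surviving chain edges (those that are slots of no gadget), the
edges of the stage-1 gadgets (diamond ladders, pins, clause gadgets) that are not stage-2 slots,
and the edges of the stage-2 rail gadgets, each with the explicit numbering of its template. It is
the dictionary between the abstract graph and its grid drawing (`GridSAWLOTDrawing*.lean`).

## References

* M. Liśkiewicz, M. Ogihara, S. Toda, TCS 304 (2003) 129–156, §3–§4.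
-/

namespace Literature.Combinatorics.SimpleGraph

namespace LOTReduction

open Finset Literature.Computability.Complexity

variable {φ : CNF ℕ}

/-! ### Unfolding the two substitution stages -/

/-- Adjacency in `graph₂`, unfolded. [folklore] -/
theorem graph₂_adj {a b : ℕ} : (graph₂ φ).Adj a b ↔
    ((graph₁ φ).Adj a b ∧ a ∈ verts₁ φ ∧ b ∈ verts₁ φ ∧ ∀ i < n₂ φ, ¬ slotOf ((placed₂ φ i).S) a b) ∨
      ∃ i < n₂ φ, (placed₂ φ i).GX.Adj a b := Iff.rfl

/-- Adjacency in `graph₁`, unfolded. [folklore] -/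
theorem graph₁_adj {a b : ℕ} : (graph₁ φ).Adj a b ↔
    ((chainG (M φ)).Adj a b ∧ a ∈ chainV (M φ) ∧ b ∈ chainV (M φ) ∧ ∀ i < n₁ φ, ¬ slotOf ((placed₁ φ i).S) a b) ∨
      ∃ i < n₁ φ, (placed₁ φ i).GX.Adj a b := Iff.rfl

/-- No stage-2 gadget has the slot `{a, b}` iff neither orientation is a stage-2 slot. [folklore] -/
theorem not_slot₂_iff {a b : ℕ} : (∀ i < n₂ φ, ¬ slotOf ((placed₂ φ i).S) a b) ↔ (a, b) ∉ SB₂ φ ∧ (b, a) ∉ SB₂ φ := by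
  simp only [slotOf, mem_SB₂, not_or, not_exists, not_and]
  exact ⟨fun h => ⟨fun i hi => (h i hi).1, fun i hi => (h i hi).2⟩, fun h i hi => ⟨h.1 i hi, h.2 i hi⟩⟩

/-- No stage-1 gadget has the slot `{a, b}` iff neither orientation is a stage-1 slot. [folklore] -/
theorem not_slot₁_iff {a b : ℕ} : (∀ i < n₁ φ, ¬ slotOf ((placed₁ φ i).S) a b) ↔ (a, b) ∉ SB₁ φ ∧ (b, a) ∉ SB₁ φ := by
  simp only [slotOf, mem_SB₁, not_or, not_exists, not_and]
  exact ⟨fun h => ⟨fun i hi => (h i hi).1, fun i hi => (h i hi).2⟩, fun h i hi => ⟨h.1 i hi, h.2 i hi⟩⟩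

/-! ### The stage-2 slots, exactly -/

/-- **The stage-2 slots are exactly** the hop slots, the set slots and the clause-link slots, in the
orientations of `slotPair₂`. [folklore] -/
theorem mem_SB₂_iff {e : ℕ × ℕ} : e ∈ SB₂ φ ↔
    (∃ c r h, c < N φ ∧ r < N φ ∧ h < 5 ∧ (e = (hopSlots' φ c r h).1 ∨ e = (hopSlots' φ c r h).2)) ∨
      (∃ c < N φ, e = (setSlots' φ c).1 ∨ e = (setSlots' φ c).2) ∨ (∃ c < N φ, e = (klinkSlots' φ c).1 ∨ e = (klinkSlots' φ c).2) := by
  rw [mem_SB₂]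
  constructor
  · rintro ⟨i, hi, he⟩
    rw [placed₂_S hi, mem_insert, mem_singleton] at he
    unfold slotPair₂ at he
    split_ifs at he with h₁ h₂
    · obtain ⟨hc, hr, hh, -⟩ := hop_idx_lt h₁
      exact Or.inl ⟨_, _, _, hc, hr, hh, he⟩
    · exact Or.inr (Or.inl ⟨_, by omega, he⟩)
    · exact Or.inr (Or.inr ⟨_, by unfold n₂ at hi; omega, he⟩)
  · rintro (⟨c, r, h, hc, hr, hh, he⟩ | ⟨c, hc, he⟩ | ⟨c, hc, he⟩)
    · obtain ⟨hsp, hlt⟩ := slotPair₂_hop hc hr hh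
      refine ⟨_, hlt, ?_⟩
      rw [placed₂_S hlt, hsp, mem_insert, mem_singleton]; exact he
    · have hlt : 5 * (N φ * N φ) + c < n₂ φ := by unfold n₂; omega
      refine ⟨_, hlt, ?_⟩
      rw [placed₂_S hlt, mem_insert, mem_singleton]
      unfold slotPair₂; rw [if_neg (by omega), if_pos (by omega), Nat.add_sub_cancel_left]; exact he
    · have hlt : 5 * (N φ * N φ) + N φ + c < n₂ φ := by unfold n₂; omega
      refine ⟨_, hlt, ?_⟩
      rw [placed₂_S hlt, mem_insert, mem_singleton]
      unfold slotPair₂; rw [if_neg (by omega), if_neg (by omega), Nat.add_sub_cancel_left]; exact he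

/-- **The stage-1 slots**: each has one of the four kinds. [folklore] -/
theorem slot1Kind_of_mem_SB₁ {e : ℕ × ℕ} (he : e ∈ SB₁ φ) : Slot1Kind φ e := by
  obtain ⟨i, hi, he⟩ := mem_SB₁.1 he
  rw [placed₁_S] at he
  exact slot1Kind_of_mem hi he

/-- The diamond-ladder slots are stage-1 slots. [folklore] -/
theorem dl_slots_mem_SB₁ {r s : ℕ} (hr : r < N φ) (hs : s < N φ) :
    slUR (blIdx φ r s) ∈ SB₁ φ ∧ slULrev (brIdx φ r s) ∈ SB₁ φ := by
  have hlt : r * N φ + s < N φ * N φ := by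
    calc r * N φ + s < r * N φ + N φ := by omega
      _ = (r + 1) * N φ := by ring
      _ ≤ N φ * N φ := Nat.mul_le_mul_right _ hr
  have hd : (r * N φ + s) / N φ = r := by rw [Nat.add_comm, Nat.add_mul_div_right _ _ (by omega), Nat.div_eq_of_lt hs, Nat.zero_add]
  have hm : (r * N φ + s) % N φ = s := by rw [Nat.add_comm, Nat.add_mul_mod_self_right, Nat.mod_eq_of_lt hs]
  have hS : (placed₁ φ (r * N φ + s)).S = {slUR (blIdx φ r s), slULrev (brIdx φ r s)} := by
    rw [placed₁_S]; unfold slots₁; rw [if_pos hlt, hd, hm]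
  have hn : r * N φ + s < n₁ φ := by unfold n₁; omega
  exact ⟨mem_SB₁.2 ⟨_, hn, by rw [hS]; simp⟩, mem_SB₁.2 ⟨_, hn, by rw [hS]; simp⟩⟩

/-- The pin slots are stage-1 slots. [folklore] -/
theorem pin_slot_mem_SB₁ {d : ℕ} (hd : d < 2 * N φ) : slUL d ∈ SB₁ φ := by
  have hn : N φ * N φ + d < n₁ φ := by unfold n₁; omega
  refine mem_SB₁.2 ⟨_, hn, ?_⟩
  rw [placed₁_S]; unfold slots₁
  rw [if_neg (by omega), if_pos (by omega), Nat.add_sub_cancel_left, mem_singleton]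

/-- The literal slots are stage-1 slots. [folklore] -/
theorem litSlot_mem_SB₁ (hN3 : N φ = 3 * T φ + 1) {c : ℕ} (hc : c < N φ) : litSlot φ c ∈ SB₁ φ := by
  by_cases h0 : c = 0
  · subst h0
    have hn : N φ * N φ + 2 * N φ < n₁ φ := by unfold n₁; omega
    refine mem_SB₁.2 ⟨_, hn, ?_⟩
    rw [placed₁_S]; unfold slots₁
    rw [if_neg (by omega), if_neg (by omega), if_pos rfl, mem_singleton]
  · set t := (c - 1) / 3 with ht
    have htT : t < T φ := by omega
    have hn : N φ * N φ + 2 * N φ + 1 + t < n₁ φ := by unfold n₁; omega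
    refine mem_SB₁.2 ⟨_, hn, ?_⟩
    rw [placed₁_S]; unfold slots₁
    rw [if_neg (by omega), if_neg (by omega), if_neg (by omega), if_pos hn, Nat.add_sub_cancel_left, mem_image]
    refine ⟨⟨(c - 1) % 3, Nat.mod_lt _ (by omega)⟩, mem_univ _, ?_⟩
    congr 1; simp only; omega

/-! ### From chain and gadget edges to `graph₂` -/

/-- Chain adjacency stays inside the chain. [folklore] -/
theorem chainG_adj_lt {a b : ℕ} (h : (chainG (M φ)).Adj a b) : a < 5 * M φ ∧ b < 5 * M φ := by
  rw [chainG_adj] at h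
  obtain ⟨-, h | h⟩ := h <;> unfold chainRelB at h <;>
    simp only [Bool.and_eq_true, Bool.or_eq_true, beq_iff_eq, decide_eq_true_eq] at h <;> omega

/-- **A chain edge that is a slot of no gadget is an edge of `graph₂`.** [folklore] -/
theorem adj₂_of_chain {a b : ℕ} (hadj : (chainG (M φ)).Adj a b) (h1 : (a, b) ∉ SB₁ φ ∧ (b, a) ∉ SB₁ φ)
    (h2 : (a, b) ∉ SB₂ φ ∧ (b, a) ∉ SB₂ φ) : (graph₂ φ).Adj a b := by
  obtain ⟨ha, hb⟩ := chainG_adj_lt hadj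
  have ha' : a ∈ chainV (M φ) := by unfold chainV; exact mem_range.2 ha
  have hb' : b ∈ chainV (M φ) := by unfold chainV; exact mem_range.2 hb
  refine graph₂_adj.2 (Or.inl ⟨graph₁_adj.2 (Or.inl ⟨hadj, ha', hb', not_slot₁_iff.2 h1⟩), ?_, ?_, not_slot₂_iff.2 h2⟩)
  · exact GadgetFamily.mem_vertsUpTo_iff.2 (Or.inl ha')
  · exact GadgetFamily.mem_vertsUpTo_iff.2 (Or.inl hb')

/-- End points of stage-1 gadget edges are stage-1 vertices. [folklore] -/
theorem mem_verts₁_of_adj₁ {i : ℕ} (hi : i < n₁ φ) {a b : ℕ} (hadj : (placed₁ φ i).GX.Adj a b) : a ∈ verts₁ φ ∧ b ∈ verts₁ φ := by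
  have hg := (valid₁ (φ := φ)).gadget_adj i hi a b hadj
  constructor
  · rcases hg.2.1 with h | h
    · exact GadgetFamily.mem_vertsUpTo_iff.2 (Or.inr ⟨i, hi, h⟩)
    · exact GadgetFamily.mem_vertsUpTo_iff.2 (Or.inl ((valid₁ (φ := φ)).ports_subset hi h))
  · rcases hg.2.2 with h | h
    · exact GadgetFamily.mem_vertsUpTo_iff.2 (Or.inr ⟨i, hi, h⟩)
    · exact GadgetFamily.mem_vertsUpTo_iff.2 (Or.inl ((valid₁ (φ := φ)).ports_subset hi h))

/-- **A stage-1 gadget edge that is not a stage-2 slot is an edge of `graph₂`.** [folklore] -/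
theorem adj₂_of_placed₁ {i : ℕ} (hi : i < n₁ φ) {a b : ℕ} (hadj : (placed₁ φ i).GX.Adj a b) (h2 : (a, b) ∉ SB₂ φ ∧ (b, a) ∉ SB₂ φ) :
    (graph₂ φ).Adj a b := by
  obtain ⟨ha, hb⟩ := mem_verts₁_of_adj₁ hi hadj
  exact graph₂_adj.2 (Or.inl ⟨graph₁_adj.2 (Or.inr ⟨i, hi, hadj⟩), ha, hb, not_slot₂_iff.2 h2⟩)

/-- **A stage-2 gadget edge is an edge of `graph₂`.** [folklore] -/
theorem adj₂_of_placed₂ {i : ℕ} (hi : i < n₂ φ) {a b : ℕ} (hadj : (placed₂ φ i).GX.Adj a b) : (graph₂ φ).Adj a b :=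
  graph₂_adj.2 (Or.inr ⟨i, hi, hadj⟩)

/-! ### The gadget edges with their numbering -/

variable (φ)

/-- **Numbering of the diamond-ladder template** of site `i = r N + s`: inner vertex `x < 24` at
`dlBase + x`, the ports `24, 25` at `a, q` of `Bl`, the ports `26, 27` at `a, p` of `Br`. [folklore] -/
def dlNum (i : ℕ) (x : Fin 28) : ℕ :=
  if x.val < 24 then dlBase φ (i / N φ) (i % N φ) + x.val
  else if x.val = 24 then (slUR (blIdx φ (i / N φ) (i % N φ))).1 else if x.val = 25 then (slUR (blIdx φ (i / N φ) (i % N φ))).2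
  else if x.val = 26 then (slULrev (brIdx φ (i / N φ) (i % N φ))).1 else (slULrev (brIdx φ (i / N φ) (i % N φ))).2

/-- **Numbering of a rail template** with block start `base` and slot ends `ends`. [folklore] -/
def railNum {k K m : ℕ} (base : ℕ) (ends : Fin k → ℕ × ℕ) : RailV k K m → ℕ
  | .node x => base + (x.1.val * K + x.2.val)
  | .mid ρ => base + (k * K + ρ.val)
  | .port r true => (ends r).1
  | .port r false => (ends r).2

variable {φ}

/-- **Edges of the diamond ladder of site `i`.** [folklore] -/
theorem placed₁_adj_dl {i : ℕ} (h₁ : i < N φ * N φ) {a b : ℕ} :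
    (placed₁ φ i).GX.Adj a b ↔ ∃ x y : Fin 28, DiamondLadder.graph.Adj x y ∧ dlNum φ i x = a ∧ dlNum φ i y = b := by
  unfold placed₁
  rw [dif_pos h₁]
  show (DiamondLadder.graph.map _).Adj a b ↔ _
  rw [_root_.SimpleGraph.map_adj]
  rfl

/-- **Edges of a placed rail gadget.** [folklore] -/
theorem RailPlacement.adj_iff (P : RailPlacement) {a b : ℕ} :
    P.GX.Adj a b ↔ ∃ x y, P.Γ.graph.Adj x y ∧ railNum P.base P.ends x = a ∧ railNum P.base P.ends y = b := by
  unfold RailPlacement.GX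
  rw [_root_.SimpleGraph.map_adj]
  have he : ∀ x, P.emb x = railNum P.base P.ends x := fun x => by
    rw [RailPlacement.emb_apply]; cases x with
    | node x => rfl
    | mid ρ => rfl
    | port r t => cases t <;> rfl
  simp only [he]

/-- **Edges of the pin with index `i`** (on dummy cell `i - N²`). [folklore] -/
theorem placed₁_adj_pin {i : ℕ} (h₁ : N φ * N φ ≤ i) (h₂ : i < N φ * N φ + 2 * N φ) {a b : ℕ} :
    (placed₁ φ i).GX.Adj a b ↔
      ∃ x y, RailOR1.Γ.graph.Adj x y ∧ railNum (K := 2) (pinBase φ (i - N φ * N φ)) (fun _ => slUL (i - N φ * N φ)) x = a ∧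
        railNum (K := 2) (pinBase φ (i - N φ * N φ)) (fun _ => slUL (i - N φ * N φ)) y = b := by
  unfold placed₁
  rw [dif_neg (by omega), dif_pos h₂]
  show (RailPlacement.GX _).Adj a b ↔ _
  rw [RailPlacement.adj_iff]
  rfl

/-- **Edges of the unit-clause gadget.** [folklore] -/
theorem placed₁_adj_cl1 {a b : ℕ} :
    (placed₁ φ (N φ * N φ + 2 * N φ)).GX.Adj a b ↔
      ∃ x y, RailOR1.Γ.graph.Adj x y ∧ railNum (K := 2) (clause1Base φ) (fun _ => litSlot φ 0) x = a ∧
        railNum (K := 2) (clause1Base φ) (fun _ => litSlot φ 0) y = b := by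
  unfold placed₁
  rw [dif_neg (by omega), dif_neg (by omega), dif_pos rfl]
  show (RailPlacement.GX _).Adj a b ↔ _
  rw [RailPlacement.adj_iff]
  rfl

/-- **Edges of the three-literal clause gadget with index `i`** (clause `i - (N² + 2N + 1)`). [folklore] -/
theorem placed₁_adj_or3 {i : ℕ} (h₁ : N φ * N φ + 2 * N φ < i) (h₂ : i < n₁ φ) {a b : ℕ} :
    (placed₁ φ i).GX.Adj a b ↔
      ∃ x y, RailOR3.Γ.graph.Adj x y ∧
        railNum (K := 6) (or3Base φ (i - (N φ * N φ + 2 * N φ + 1))) (fun r => litSlot φ (3 * (i - (N φ * N φ + 2 * N φ + 1)) + 1 + r.val)) x = a ∧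
        railNum (K := 6) (or3Base φ (i - (N φ * N φ + 2 * N φ + 1))) (fun r => litSlot φ (3 * (i - (N φ * N φ + 2 * N φ + 1)) + 1 + r.val)) y = b := by
  unfold placed₁
  rw [dif_neg (by omega), dif_neg (by omega), dif_neg (by omega), dif_pos h₂]
  show (RailPlacement.GX _).Adj a b ↔ _
  rw [RailPlacement.adj_iff]
  rfl

/-- The slot ends of a stage-2 rail gadget. [folklore] -/
def ends₂ (p : (ℕ × ℕ) × (ℕ × ℕ)) (r : Fin 2) : ℕ × ℕ := if r = 0 then p.1 else p.2

/-- **Edges of stage-2 gadget `i`.** [folklore] -/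
theorem placed₂_adj {i : ℕ} (hi : i < n₂ φ) {a b : ℕ} :
    (placed₂ φ i).GX.Adj a b ↔
      ∃ x y, RailXOR.Γ.graph.Adj x y ∧ railNum (K := 4) (base2 φ + 12 * i) (ends₂ (slotPair₂ φ i)) x = a ∧
        railNum (K := 4) (base2 φ + 12 * i) (ends₂ (slotPair₂ φ i)) y = b := by
  unfold placed₂
  rw [dif_pos hi]
  show (RailPlacement.GX _).Adj a b ↔ _
  rw [RailPlacement.adj_iff]
  rfl

/-! ### Template adjacency, by `decide` on concrete vertices -/

/-- Rail edges of the XOR-gadget. [folklore] -/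
theorem RailXOR.adj_rail (r : Fin 2) (t : Fin 4) (t' : Fin 4) (h : t.val + 1 = t'.val) :
    RailXOR.Γ.graph.Adj (.node (r, t)) (.node (r, t')) := by
  revert r t t' h; decide

/-- Rung halves of the XOR-gadget. [folklore] -/
theorem RailXOR.adj_rung (r : Fin 2) (t : Fin 4) : RailXOR.Γ.graph.Adj (.node (r, t)) (.mid t) := by
  revert r t; decide

/-- Port edges of the XOR-gadget. [folklore] -/
theorem RailXOR.adj_port (r : Fin 2) : RailXOR.Γ.graph.Adj (.port r true) (.node (r, 0)) ∧ RailXOR.Γ.graph.Adj (.port r false) (.node (r, 3)) := by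
  revert r; decide

/-- Edges of the one-input OR-gadget. [folklore] -/
theorem RailOR1.adj_all : RailOR1.Γ.graph.Adj (.node (0, 0)) (.node (0, 1)) ∧ RailOR1.Γ.graph.Adj (.node (0, 0)) (.mid 0) ∧
    RailOR1.Γ.graph.Adj (.node (0, 1)) (.mid 0) ∧ RailOR1.Γ.graph.Adj (.port 0 true) (.node (0, 0)) ∧
    RailOR1.Γ.graph.Adj (.port 0 false) (.node (0, 1)) := by
  decide

/-- Rail edges of the three-input OR-gadget. [folklore] -/
theorem RailOR3.adj_rail (r : Fin 3) (t : Fin 6) (t' : Fin 6) (h : t.val + 1 = t'.val) :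
    RailOR3.Γ.graph.Adj (.node (r, t)) (.node (r, t')) := by
  revert r t t' h; decide

/-- Rung halves of the three-input OR-gadget. [folklore] -/
theorem RailOR3.adj_rung (ρ : Fin 9) : RailOR3.Γ.graph.Adj (.node (RailOR3.fst ρ)) (.mid ρ) ∧ RailOR3.Γ.graph.Adj (.node (RailOR3.snd ρ)) (.mid ρ) := by
  revert ρ; decide

/-- Port edges of the three-input OR-gadget. [folklore] -/
theorem RailOR3.adj_port (r : Fin 3) : RailOR3.Γ.graph.Adj (.port r true) (.node (r, 0)) ∧ RailOR3.Γ.graph.Adj (.port r false) (.node (r, 5)) := by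
  revert r; decide

/-- The edges of the diamond ladder, by number. [folklore] -/
theorem DiamondLadder.adj_of_mem {x y : Fin 28} (h : (x, y) ∈ DiamondLadder.edges) : DiamondLadder.graph.Adj x y := by
  rw [DiamondLadder.graph_adj]
  revert x y; decide

/-! ### Cells are told apart -/

/-- A bus cell is not a door cell. [folklore] -/
theorem blIdx_ne_wIdx {r s r' s' : ℕ} (hs : s ≤ N φ) (hs' : s' < N φ) : blIdx φ r s ≠ wIdx φ r' s' := by
  intro h
  have := (rowCell_inj (φ := φ) (by omega) (by omega) h).2
  omega

/-- `Br` of a site is `Bl` of the next. [folklore] -/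
theorem brIdx_eq (r j : ℕ) : brIdx φ r j = blIdx φ r (j + 1) := by unfold brIdx blIdx; ring_nf

/-- Bus cells are told apart. [folklore] -/
theorem blIdx_inj {r s r' s' : ℕ} (hs : s ≤ N φ) (hs' : s' ≤ N φ) (h : blIdx φ r s = blIdx φ r' s') : r = r' ∧ s = s' := by
  have := rowCell_inj (φ := φ) (by omega) (by omega) h; omega

/-- Door cells are told apart. [folklore] -/
theorem wIdx_inj {r s r' s' : ℕ} (hs : s < N φ) (hs' : s' < N φ) (h : wIdx φ r s = wIdx φ r' s') : r = r' ∧ s = s' := by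
  have := rowCell_inj (φ := φ) (by omega) (by omega) h; omega

/-! ### Which chain edges are slots: the forms -/

/-- **The stage-1 slots, by form.** [folklore] -/
theorem SB₁_forms (hN : 0 < N φ) {e : ℕ × ℕ} (he : e ∈ SB₁ φ) :
    (∃ r j, r < N φ ∧ j < N φ ∧ (e = slUR (blIdx φ r j) ∨ e = slULrev (brIdx φ r j))) ∨ (∃ d < 2 * N φ, e = slUL d) ∨
      ∃ c < N φ, e = litSlot φ c := by
  rcases slot1Kind_of_mem_SB₁ he with ⟨r, j, hr, hj⟩ | ⟨r, j, hr, hj⟩ | ⟨d, hd⟩ | ⟨c, hc⟩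
  · exact Or.inl ⟨r, j, hr, hj, Or.inl rfl⟩
  · exact Or.inl ⟨r, j, hr, hj, Or.inr rfl⟩
  · exact Or.inr (Or.inl ⟨d, hd, rfl⟩)
  · exact Or.inr (Or.inr ⟨c, by omega, rfl⟩)

/-- **The stage-2 slots between chain vertices, by form** (coarsely: which `sl··`, possibly reversed). [folklore] -/
theorem SB₂_chain_forms {e : ℕ × ℕ} (he : e ∈ SB₂ φ) (h1 : e.1 < base1 φ) :
    (∃ r c, r < N φ ∧ c < N φ ∧ (e = (above φ r c).swap ∨ (r = N φ - 1 ∧ e = (below φ r c).swap))) ∨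
      (∃ r j, r < N φ ∧ j < N φ ∧ e = slUL (wIdx φ r j)) ∨
      (∃ c < N φ, (prev? φ c).isSome = true ∧ (e = slLL (wIdx φ c (J φ c c)) ∨ e = (slLL (brIdx φ c (J φ c c))).swap)) ∨
      (∃ c < N φ, (prev? φ c).isSome = false ∧ (e = slLR (dIdx c) ∨ e = (slLL (d'Idx c)).swap)) ∨
      (∃ c < N φ, e = slUL (kIdx φ c)) := by
  rcases mem_SB₂_iff.1 he with ⟨c, r, h, hc, hr, hh, he⟩ | ⟨c, hc, he⟩ | ⟨c, hc, he⟩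
  · have hj := J_lt (φ := φ) (r := r) hc
    revert he; unfold hopSlots' hopSlots
    by_cases h0 : h = 0
    · subst h0; simp only [if_true]
      rintro (rfl | rfl)
      · exact Or.inl ⟨r, c, hr, hc, Or.inl rfl⟩
      · exfalso; have := (hopUL_bounds hr hj 0 (by omega)).1; unfold hopUL dlBase at h1 this; simp only at h1; omega
    · rw [if_neg h0, if_neg h0]
      split_ifs with h4 <;> rintro (rfl | rfl)
      · exfalso; unfold hopLL dlBase at h1; simp only at h1; omega
      · exact Or.inr (Or.inl ⟨r, _, hr, hj, rfl⟩)
      · exfalso; unfold hopLL dlBase at h1; simp only at h1; omega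
      · exfalso; unfold hopUL dlBase at h1; simp only at h1; omega
  · revert he; unfold setSlots'
    cases hp : (prev? φ c).isSome
    · simp only [Bool.false_eq_true, if_false]
      rintro (rfl | rfl) <;> exact Or.inr (Or.inr (Or.inr (Or.inl ⟨c, hc, hp, by tauto⟩)))
    · simp only [if_true]
      rintro (rfl | rfl) <;> exact Or.inr (Or.inr (Or.inl ⟨c, hc, hp, by tauto⟩))
  · revert he; unfold klinkSlots'
    rintro (rfl | rfl)
    · exact Or.inl ⟨N φ - 1, c, by omega, hc, Or.inr ⟨rfl, rfl⟩⟩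
    · exact Or.inr (Or.inr (Or.inr (Or.inr ⟨c, hc, rfl⟩)))

/-- Stage-2 slots do not join a chain vertex to a gadget vertex. [folklore] -/
theorem SB₂_not_mixed {e : ℕ × ℕ} (he : e ∈ SB₂ φ) : e.1 < base1 φ ↔ e.2 < base1 φ := by
  by_cases h1 : e.1 < base1 φ
  · simp only [h1, true_iff]
    rcases SB₂_chain_forms he h1 with ⟨r, c, hr, hc, h⟩ | ⟨r, j, hr, hj, rfl⟩ | ⟨c, hc, -, h⟩ | ⟨c, hc, -, h⟩ | ⟨c, hc, rfl⟩
    · have hab := above_bounds hr hc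
      have hbb := below_bounds (φ := φ) hr hc
      rcases h with rfl | ⟨-, rfl⟩ <;> simp only [Prod.snd_swap] <;> omega
    · have := five_cell_lt_base1 φ (rowCell_lt_M hr (k := 2 * j + 1) (by omega))
      show 5 * wIdx φ r j + 2 < base1 φ; unfold wIdx; omega
    · have hj := J_lt (φ := φ) (r := c) hc
      have h2 := five_cell_lt_base1 φ (rowCell_lt_M hc (k := 2 * J φ c c + 1) (by omega))
      have h3 := five_cell_lt_base1 φ (rowCell_lt_M hc (k := 2 * J φ c c + 2) (by omega))
      rcases h with rfl | rfl
      · show 5 * wIdx φ c (J φ c c) + 3 < base1 φ; unfold wIdx; omega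
      · show 5 * brIdx φ c (J φ c c) + 1 < base1 φ; unfold brIdx; omega
    · have h2 := five_cell_lt_base1 φ (dIdx_lt_M hc)
      have h3 : 5 * d'Idx c + 4 < base1 φ := by have := five_cell_lt_base1 φ (show 2 * c + 1 < M φ by unfold M; omega); unfold d'Idx; omega
      rcases h with rfl | rfl
      · show 5 * dIdx c + 4 < base1 φ; omega
      · show 5 * d'Idx c + 1 < base1 φ; omega
    · have := five_cell_lt_base1 φ (kIdx_lt_M hc)
      show 5 * kIdx φ c + 2 < base1 φ; omega
  · simp only [h1, false_iff, not_lt]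
    have hh : IsHop φ e := by unfold IsHop; omega
    obtain ⟨r, j, k, hr, hj, hk, h⟩ := SB₂_hop he hh
    rcases h with rfl | rfl
    · unfold hopUL; simp only; unfold dlBase; omega
    · unfold hopLL; simp only; unfold dlBase; omega

/-- **Decreasing pairs of gadget vertices are not stage-2 slots.** [folklore] -/
theorem not_mem_SB₂_of_gt {a b : ℕ} (hb : base1 φ ≤ b) (hab : b < a) : (a, b) ∉ SB₂ φ := fun h => by
  have hh : IsHop φ (a, b) := by unfold IsHop; simp only; omega
  have := canon_eq_of_mem_SB₂ h hh
  unfold canon at this; simp only at this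
  rw [if_neg (by omega)] at this
  simp only [Prod.swap_prod_mk, Prod.mk.injEq] at this
  omega

/-- **Edges between a chain vertex and a gadget vertex are not stage-2 slots**, either way. [folklore] -/
theorem not_SB₂_mixed {a b : ℕ} (ha : a < base1 φ) (hb : base1 φ ≤ b) : (a, b) ∉ SB₂ φ ∧ (b, a) ∉ SB₂ φ :=
  ⟨fun h => by have := (SB₂_not_mixed h).1 ha; simp only at this; omega,
    fun h => by have := (SB₂_not_mixed h).2 ha; simp only at this; omega⟩

/-- **Edges between two gadget vertices other than the hop edges are not stage-2 slots**: inside a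
diamond-ladder block only `p a`, `p b` of a diamond are. [folklore] -/
theorem not_SB₂_dl {r s : ℕ} (hr : r < N φ) (hs : s < N φ) {x y : ℕ} (hxy : x < y) (hy : y < 24)
    (h : ∀ k < 4, ¬ (x = 8 + 4 * k ∧ (y = 9 + 4 * k ∨ y = 10 + 4 * k))) :
    (dlBase φ r s + x, dlBase φ r s + y) ∉ SB₂ φ ∧ (dlBase φ r s + y, dlBase φ r s + x) ∉ SB₂ φ := by
  refine ⟨fun hm => ?_, not_mem_SB₂_of_gt (by unfold dlBase; omega) (by omega)⟩
  have hh : IsHop φ (dlBase φ r s + x, dlBase φ r s + y) := by unfold IsHop dlBase; simp only; omega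
  obtain ⟨r', j', k, hr', hj', hk, he⟩ := SB₂_hop hm hh
  have hlt : r * N φ + s < N φ * N φ := by
    calc r * N φ + s < r * N φ + N φ := by omega
      _ = (r + 1) * N φ := by ring
      _ ≤ N φ * N φ := Nat.mul_le_mul_right _ hr
  have hlt' : r' * N φ + j' < N φ * N φ := by
    calc r' * N φ + j' < r' * N φ + N φ := by omega
      _ = (r' + 1) * N φ := by ring
      _ ≤ N φ * N φ := Nat.mul_le_mul_right _ hr'
  rcases he with he | he <;> [unfold hopUL at he; unfold hopLL at he] <;> unfold dlBase at he <;>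
    simp only [Prod.mk.injEq] at he <;> exact h k hk ⟨by omega, by omega⟩

/-! ### Residues of the slot forms -/

/-- **Residues of the stage-1 slots**: `UR = (2, 4)`, `ULᵒᵖ = (2, 1)`, `UL = (1, 2)`, literal `LL = (1, 3)`
or `LR = (3, 4)` (mod `5`), within one cell. [folklore] -/
theorem SB₁_res (hN : 0 < N φ) {e : ℕ × ℕ} (he : e ∈ SB₁ φ) :
    e.1 / 5 = e.2 / 5 ∧ ((e.1 % 5 = 2 ∧ e.2 % 5 = 4) ∨ (e.1 % 5 = 2 ∧ e.2 % 5 = 1) ∨ (e.1 % 5 = 1 ∧ e.2 % 5 = 2) ∨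
      (e.1 % 5 = 1 ∧ e.2 % 5 = 3) ∨ (e.1 % 5 = 3 ∧ e.2 % 5 = 4)) := by
  rcases SB₁_forms hN he with ⟨r, j, -, -, rfl | rfl⟩ | ⟨d, -, rfl⟩ | ⟨c, -, rfl⟩
  · unfold slUR; simp only; omega
  · unfold slULrev; simp only; omega
  · unfold slUL; simp only; omega
  · unfold litSlot; split_ifs <;> [unfold slLL; unfold slLR] <;> simp only <;> omega

/-- **Residues of the stage-2 slots between chain vertices**: `(3, 1)` or `(4, 3)` (reversed exits),
`UL = (1, 2)`, `LL = (1, 3)`, `LLᵒᵖ = (3, 1)`, `LR = (3, 4)`, within one cell. [folklore] -/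
theorem SB₂_chain_res {e : ℕ × ℕ} (he : e ∈ SB₂ φ) (h1 : e.1 < base1 φ) :
    e.1 / 5 = e.2 / 5 ∧ ((e.1 % 5 = 3 ∧ e.2 % 5 = 1) ∨ (e.1 % 5 = 4 ∧ e.2 % 5 = 3) ∨ (e.1 % 5 = 1 ∧ e.2 % 5 = 2) ∨
      (e.1 % 5 = 1 ∧ e.2 % 5 = 3) ∨ (e.1 % 5 = 3 ∧ e.2 % 5 = 4)) := by
  rcases SB₂_chain_forms he h1 with ⟨r, c, -, -, h⟩ | ⟨r, j, -, -, rfl⟩ | ⟨c, -, -, rfl | rfl⟩ | ⟨c, -, -, rfl | rfl⟩ | ⟨c, -, rfl⟩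
  · have key : ∀ r c, ((below φ r c).swap.1 / 5 = (below φ r c).swap.2 / 5) ∧
        (((below φ r c).swap.1 % 5 = 3 ∧ (below φ r c).swap.2 % 5 = 1) ∨ ((below φ r c).swap.1 % 5 = 4 ∧ (below φ r c).swap.2 % 5 = 3)) := by
      intro r c; unfold below; split_ifs <;> [unfold slLR; unfold slLL] <;> simp only [Prod.fst_swap, Prod.snd_swap] <;> omega
    rcases h with rfl | ⟨-, rfl⟩
    · unfold above; split_ifs
      · unfold slLL; simp only [Prod.fst_swap, Prod.snd_swap]; omega
      · have := key (r - 1) c; tauto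
    · have := key r c; tauto
  · unfold slUL; simp only; omega
  · unfold slLL; simp only; omega
  · unfold slLL; simp only [Prod.fst_swap, Prod.snd_swap]; omega
  · unfold slLR; simp only; omega
  · unfold slLL; simp only [Prod.fst_swap, Prod.snd_swap]; omega
  · unfold slUL; simp only; omega

/-- Residues of the reversed exits. [folklore] -/
theorem below_swap_res (r c : ℕ) : ((below φ r c).swap.1 % 5 = 3 ∧ (below φ r c).swap.2 % 5 = 1) ∨
    ((below φ r c).swap.1 % 5 = 4 ∧ (below φ r c).swap.2 % 5 = 3) := by
  unfold below; split_ifs <;> [unfold slLR; unfold slLL] <;> simp only [Prod.fst_swap, Prod.snd_swap] <;> omega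

/-- Residues of the reversed entries. [folklore] -/
theorem above_swap_res (r c : ℕ) : ((above φ r c).swap.1 % 5 = 3 ∧ (above φ r c).swap.2 % 5 = 1) ∨
    ((above φ r c).swap.1 % 5 = 4 ∧ (above φ r c).swap.2 % 5 = 3) := by
  unfold above; split_ifs
  · unfold slLL; simp only [Prod.fst_swap, Prod.snd_swap]; omega
  · exact below_swap_res _ _

/-- **An edge `{a, b}` of the chain that is a slot of no gadget**, in the form needed by `adj₂_of_chain`. [folklore] -/
def NotSlot (φ : CNF ℕ) (a b : ℕ) : Prop := ((a, b) ∉ SB₁ φ ∧ (b, a) ∉ SB₁ φ) ∧ ((a, b) ∉ SB₂ φ ∧ (b, a) ∉ SB₂ φ)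

/-- Residue test: a chain pair whose residues match no slot form either way is a slot of no gadget. [folklore] -/
theorem notSlot_of_res (hN : 0 < N φ) {a b : ℕ} (hb : b < base1 φ) (ha : a < base1 φ)
    (h : ¬ ((a % 5 = 2 ∧ b % 5 = 4) ∨ (a % 5 = 2 ∧ b % 5 = 1) ∨ (a % 5 = 1 ∧ b % 5 = 2) ∨ (a % 5 = 1 ∧ b % 5 = 3) ∨ (a % 5 = 3 ∧ b % 5 = 4) ∨
      (a % 5 = 3 ∧ b % 5 = 1) ∨ (a % 5 = 4 ∧ b % 5 = 3)) ∨ a / 5 ≠ b / 5)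
    (h' : ¬ ((b % 5 = 2 ∧ a % 5 = 4) ∨ (b % 5 = 2 ∧ a % 5 = 1) ∨ (b % 5 = 1 ∧ a % 5 = 2) ∨ (b % 5 = 1 ∧ a % 5 = 3) ∨ (b % 5 = 3 ∧ a % 5 = 4) ∨
      (b % 5 = 3 ∧ a % 5 = 1) ∨ (b % 5 = 4 ∧ a % 5 = 3)) ∨ a / 5 ≠ b / 5) : NotSlot φ a b := by
  refine ⟨⟨fun hm => ?_, fun hm => ?_⟩, fun hm => ?_, fun hm => ?_⟩
  · have := SB₁_res hN hm; simp only at this; omega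
  · have := SB₁_res hN hm; simp only at this; omega
  · have := SB₂_chain_res hm ha; simp only at this; omega
  · have := SB₂_chain_res hm hb; simp only at this; omega

/-- `c p` edges are slots of no gadget. [folklore] -/
theorem notSlot_cp (hN : 0 < N φ) {i : ℕ} (hi : i < M φ) : NotSlot φ (5 * i) (5 * i + 1) := by
  have := five_cell_lt_base1 φ hi
  exact notSlot_of_res hN (by omega) (by omega) (by omega) (by omega)

/-- `a b` edges are slots of no gadget. [folklore] -/
theorem notSlot_ab (hN : 0 < N φ) {i : ℕ} (hi : i < M φ) : NotSlot φ (5 * i + 2) (5 * i + 3) := by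
  have := five_cell_lt_base1 φ hi
  exact notSlot_of_res hN (by omega) (by omega) (by omega) (by omega)

/-- The connector edges `q c'` are slots of no gadget. [folklore] -/
theorem notSlot_qc (hN : 0 < N φ) {i : ℕ} (hi : i + 1 < M φ) : NotSlot φ (5 * i + 4) (5 * i + 5) := by
  have := five_cell_lt_base1 φ hi
  exact notSlot_of_res hN (by omega) (by omega) (by omega) (by omega)

/-- **`UR` edges of cells without a diamond ladder are slots of no gadget**: the only `(2, 4)` slots
are the `e`-slots of the diamond ladders, on `Bl_s` (`s < N`). [folklore] -/
theorem notSlot_UR (hN : 0 < N φ) {i : ℕ} (hi : i < M φ) (h : ∀ r j, r < N φ → j < N φ → i ≠ blIdx φ r j) :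
    NotSlot φ (5 * i + 2) (5 * i + 4) := by
  have h5 := five_cell_lt_base1 φ hi
  refine ⟨⟨fun hm => ?_, fun hm => ?_⟩, fun hm => ?_, fun hm => ?_⟩
  · rcases SB₁_forms hN hm with ⟨r, j, hr, hj, he | he⟩ | ⟨d, -, he⟩ | ⟨c, -, he⟩
    · unfold slUR at he; simp only [Prod.mk.injEq] at he; exact h r j hr hj (by omega)
    · unfold slULrev at he; simp only [Prod.mk.injEq] at he; omega
    · unfold slUL at he; simp only [Prod.mk.injEq] at he; omega
    · unfold litSlot at he; split_ifs at he <;> [unfold slLL at he; unfold slLR at he] <;> simp only [Prod.mk.injEq] at he <;> omega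
  · have := SB₁_res hN hm; simp only at this; omega
  · have := SB₂_chain_res hm (by simp only; omega); simp only at this; omega
  · have := SB₂_chain_res hm (by simp only; omega); simp only at this; omega

/-- **`UL` edges**: slots of no gadget unless a pin (dummy cells), a reversed `f`-slot (`Bl_s`,
`s ≥ 1`), a door (`W`) or a clause cell (`K`). [folklore] -/
theorem notSlot_UL (hN : 0 < N φ) {i : ℕ} (hi : i < M φ) (hd : 2 * N φ ≤ i) (hbr : ∀ r j, r < N φ → j < N φ → i ≠ brIdx φ r j)
    (hw : ∀ r j, r < N φ → j < N φ → i ≠ wIdx φ r j) (hk : ∀ c, c < N φ → i ≠ kIdx φ c) :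
    NotSlot φ (5 * i + 1) (5 * i + 2) := by
  have h5 := five_cell_lt_base1 φ hi
  refine ⟨⟨fun hm => ?_, fun hm => ?_⟩, fun hm => ?_, fun hm => ?_⟩
  · rcases SB₁_forms hN hm with ⟨r, j, hr, hj, he | he⟩ | ⟨d, hd', he⟩ | ⟨c, -, he⟩
    · unfold slUR at he; simp only [Prod.mk.injEq] at he; omega
    · unfold slULrev at he; simp only [Prod.mk.injEq] at he; omega
    · unfold slUL at he; simp only [Prod.mk.injEq] at he; omega
    · unfold litSlot at he; split_ifs at he <;> [unfold slLL at he; unfold slLR at he] <;> simp only [Prod.mk.injEq] at he <;> omega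
  · rcases SB₁_forms hN hm with ⟨r, j, hr, hj, he | he⟩ | ⟨d, hd', he⟩ | ⟨c, -, he⟩
    · unfold slUR at he; simp only [Prod.mk.injEq] at he; omega
    · unfold slULrev at he; simp only [Prod.mk.injEq] at he; exact hbr r j hr hj (by omega)
    · unfold slUL at he; simp only [Prod.mk.injEq] at he; omega
    · unfold litSlot at he; split_ifs at he <;> [unfold slLL at he; unfold slLR at he] <;> simp only [Prod.mk.injEq] at he <;> omega
  · rcases SB₂_chain_forms hm (by simp only; omega) with ⟨r, c, hr, hc, he⟩ | ⟨r, j, hr, hj, he⟩ | ⟨c, hc, -, he | he⟩ | ⟨c, hc, -, he | he⟩ | ⟨c, hc, he⟩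
    · rcases he with he | ⟨-, he⟩
      · have := above_swap_res (φ := φ) r c; rw [← he] at this; simp only at this; omega
      · have := below_swap_res (φ := φ) r c; rw [← he] at this; simp only at this; omega
    · unfold slUL at he; simp only [Prod.mk.injEq] at he; exact hw r j hr hj (by omega)
    · unfold slLL at he; simp only [Prod.mk.injEq] at he; omega
    · unfold slLL at he; simp only [Prod.swap_prod_mk, Prod.mk.injEq] at he; omega
    · unfold slLR at he; simp only [Prod.mk.injEq] at he; omega
    · unfold slLL at he; simp only [Prod.swap_prod_mk, Prod.mk.injEq] at he; omega
    · unfold slUL at he; simp only [Prod.mk.injEq] at he; exact hk c hc (by omega)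
  · have := SB₂_chain_res hm (by simp only; omega); simp only at this; omega

/-- **`LR` edges**: slots of no gadget unless a negative literal's slot (`K`), the vacuous dummy
slot (`D_c`, no previous occurrence), or — reversed — the tap of a tapping column (`Bl`). [folklore] -/
theorem notSlot_LR (hN : 0 < N φ) {i : ℕ} (hi : i < M φ)
    (hk : ∀ c, c < N φ → i = kIdx φ c → FormulaCells.polOf φ c = true)
    (hdm : ∀ c, c < N φ → i = dIdx c → (prev? φ c).isSome = true)
    (hbl : ∀ r c, r < N φ → c < N φ → i = blIdx φ r (J φ r c) → ¬ IsTap φ r c) :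
    NotSlot φ (5 * i + 3) (5 * i + 4) := by
  have h5 := five_cell_lt_base1 φ hi
  refine ⟨⟨fun hm => ?_, fun hm => ?_⟩, fun hm => ?_, fun hm => ?_⟩
  · rcases SB₁_forms hN hm with ⟨r, j, hr, hj, he | he⟩ | ⟨d, hd', he⟩ | ⟨c, hc, he⟩
    · unfold slUR at he; simp only [Prod.mk.injEq] at he; omega
    · unfold slULrev at he; simp only [Prod.mk.injEq] at he; omega
    · unfold slUL at he; simp only [Prod.mk.injEq] at he; omega
    · unfold litSlot at he; split_ifs at he with hp
      · unfold slLL at he; simp only [Prod.mk.injEq] at he; omega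
      · unfold slLR at he; simp only [Prod.mk.injEq] at he
        have := hk c hc (by omega); rw [this] at hp; exact hp rfl
  · have := SB₁_res hN hm; simp only at this; omega
  · rcases SB₂_chain_forms hm (by simp only; omega) with ⟨r, c, hr, hc, he⟩ | ⟨r, j, hr, hj, he⟩ | ⟨c, hc, -, he | he⟩ | ⟨c, hc, hp, he | he⟩ | ⟨c, hc, he⟩
    · rcases he with he | ⟨-, he⟩
      · have := above_swap_res (φ := φ) r c; rw [← he] at this; simp only at this; omega
      · have := below_swap_res (φ := φ) r c; rw [← he] at this; simp only at this; omega
    · unfold slUL at he; simp only [Prod.mk.injEq] at he; omega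
    · unfold slLL at he; simp only [Prod.mk.injEq] at he; omega
    · unfold slLL at he; simp only [Prod.swap_prod_mk, Prod.mk.injEq] at he; omega
    · unfold slLR at he; simp only [Prod.mk.injEq] at he
      have := hdm c hc (by omega); rw [this] at hp; exact Bool.noConfusion hp
    · unfold slLL at he; simp only [Prod.swap_prod_mk, Prod.mk.injEq] at he; omega
    · unfold slUL at he; simp only [Prod.mk.injEq] at he; omega
  · -- reversed: `(q, b)` is the reversed exit of a tapping column
    rcases SB₂_chain_forms hm (by simp only; omega) with ⟨r, c, hr, hc, he⟩ | ⟨r, j, hr, hj, he⟩ | ⟨c, hc, -, he | he⟩ | ⟨c, hc, hp, he | he⟩ | ⟨c, hc, he⟩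
    · have hbelow : ∀ r', r' < N φ → (5 * i + 4, 5 * i + 3) = (below φ r' c).swap → False := by
        intro r' hr' he
        unfold below at he
        split_ifs at he with ht
        · unfold slLR at he; simp only [Prod.swap_prod_mk, Prod.mk.injEq] at he
          exact hbl r' c hr' hc (by omega) ht
        · unfold slLL at he; simp only [Prod.swap_prod_mk, Prod.mk.injEq] at he; omega
      rcases he with he | ⟨-, he⟩
      · unfold above at he
        split_ifs at he with h0
        · unfold slLL at he; simp only [Prod.swap_prod_mk, Prod.mk.injEq] at he; omega
        · exact hbelow (r - 1) (by omega) he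
      · exact hbelow r hr he
    · unfold slUL at he; simp only [Prod.mk.injEq] at he; omega
    · unfold slLL at he; simp only [Prod.mk.injEq] at he; omega
    · unfold slLL at he; simp only [Prod.swap_prod_mk, Prod.mk.injEq] at he; omega
    · unfold slLR at he; simp only [Prod.mk.injEq] at he; omega
    · unfold slLL at he; simp only [Prod.swap_prod_mk, Prod.mk.injEq] at he; omega
    · unfold slUL at he; simp only [Prod.mk.injEq] at he; omega

/-- **`LL` edges**: slots of no gadget unless a positive literal's slot (`K`), the first set slot
(`W` of the set site), the entry of row `0` (`D_c`) or — reversed — the second set slot (`Br` of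
the set site, or `D'_c` when vacuous), or the reversed door exit of a non-tapping column (`W`). [folklore] -/
theorem notSlot_LL (hN : 0 < N φ) {i : ℕ} (hi : i < M φ)
    (hk : ∀ c, c < N φ → i = kIdx φ c → FormulaCells.polOf φ c = false)
    (hws : ∀ c, c < N φ → i = wIdx φ c (J φ c c) → (prev? φ c).isSome = false)
    (hd : ∀ c, c < N φ → i ≠ dIdx c)
    (hbr : ∀ c, c < N φ → i = brIdx φ c (J φ c c) → (prev? φ c).isSome = false)
    (hd' : ∀ c, c < N φ → i = d'Idx c → (prev? φ c).isSome = true)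
    (hwt : ∀ r c, r < N φ → c < N φ → i = wIdx φ r (J φ r c) → IsTap φ r c) :
    NotSlot φ (5 * i + 1) (5 * i + 3) := by
  have h5 := five_cell_lt_base1 φ hi
  refine ⟨⟨fun hm => ?_, fun hm => ?_⟩, fun hm => ?_, fun hm => ?_⟩
  · rcases SB₁_forms hN hm with ⟨r, j, hr, hj, he | he⟩ | ⟨d, hd', he⟩ | ⟨c, hc, he⟩
    · unfold slUR at he; simp only [Prod.mk.injEq] at he; omega
    · unfold slULrev at he; simp only [Prod.mk.injEq] at he; omega
    · unfold slUL at he; simp only [Prod.mk.injEq] at he; omega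
    · unfold litSlot at he; split_ifs at he with hp
      · unfold slLL at he; simp only [Prod.mk.injEq] at he
        have := hk c hc (by omega); rw [this] at hp; exact Bool.noConfusion hp
      · unfold slLR at he; simp only [Prod.mk.injEq] at he; omega
  · have := SB₁_res hN hm; simp only at this; omega
  · rcases SB₂_chain_forms hm (by simp only; omega) with ⟨r, c, hr, hc, he⟩ | ⟨r, j, hr, hj, he⟩ | ⟨c, hc, hp, he | he⟩ | ⟨c, hc, hp, he | he⟩ | ⟨c, hc, he⟩
    · rcases he with he | ⟨-, he⟩
      · have := above_swap_res (φ := φ) r c; rw [← he] at this; simp only at this; omega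
      · have := below_swap_res (φ := φ) r c; rw [← he] at this; simp only at this; omega
    · unfold slUL at he; simp only [Prod.mk.injEq] at he; omega
    · unfold slLL at he; simp only [Prod.mk.injEq] at he
      have := hws c hc (by omega); rw [this] at hp; exact Bool.noConfusion hp
    · unfold slLL at he; simp only [Prod.swap_prod_mk, Prod.mk.injEq] at he; omega
    · unfold slLR at he; simp only [Prod.mk.injEq] at he; omega
    · unfold slLL at he; simp only [Prod.swap_prod_mk, Prod.mk.injEq] at he; omega
    · unfold slUL at he; simp only [Prod.mk.injEq] at he; omega
  · rcases SB₂_chain_forms hm (by simp only; omega) with ⟨r, c, hr, hc, he⟩ | ⟨r, j, hr, hj, he⟩ | ⟨c, hc, hp, he | he⟩ | ⟨c, hc, hp, he | he⟩ | ⟨c, hc, he⟩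
    · have hbelow : ∀ r', r' < N φ → (5 * i + 3, 5 * i + 1) = (below φ r' c).swap → False := by
        intro r' hr' he
        unfold below at he
        split_ifs at he with ht
        · unfold slLR at he; simp only [Prod.swap_prod_mk, Prod.mk.injEq] at he; omega
        · unfold slLL at he; simp only [Prod.swap_prod_mk, Prod.mk.injEq] at he
          exact ht (hwt r' c hr' hc (by omega))
      rcases he with he | ⟨-, he⟩
      · unfold above at he
        split_ifs at he with h0
        · unfold slLL at he; simp only [Prod.swap_prod_mk, Prod.mk.injEq] at he; exact hd c hc (by omega)
        · exact hbelow (r - 1) (by omega) he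
      · exact hbelow r hr he
    · unfold slUL at he; simp only [Prod.mk.injEq] at he; omega
    · unfold slLL at he; simp only [Prod.mk.injEq] at he; omega
    · unfold slLL at he; simp only [Prod.swap_prod_mk, Prod.mk.injEq] at he
      have := hbr c hc (by omega); rw [this] at hp; exact Bool.noConfusion hp
    · unfold slLR at he; simp only [Prod.mk.injEq] at he; omega
    · unfold slLL at he; simp only [Prod.swap_prod_mk, Prod.mk.injEq] at he
      have := hd' c hc (by omega); rw [this] at hp; exact Bool.noConfusion hp
    · unfold slUL at he; simp only [Prod.mk.injEq] at he; omega

/-! ### Introduction rules for the edges of `graph₂`, with the numbering of the drawing -/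

/-- Chain adjacency from the edge pattern. [folklore] -/
theorem chain_adj_of {u v : ℕ} (hv : v < 5 * M φ)
    (h : (u % 5 = 0 ∧ v = u + 1) ∨ (u % 5 = 1 ∧ (v = u + 1 ∨ v = u + 2)) ∨ (u % 5 = 2 ∧ (v = u + 1 ∨ v = u + 2)) ∨
      (u % 5 = 3 ∧ v = u + 1) ∨ (u % 5 = 4 ∧ v = u + 1)) : (chainG (M φ)).Adj u v := by
  rw [chainG_adj]
  refine ⟨by omega, Or.inl ?_⟩
  unfold chainRelB
  simp only [Bool.and_eq_true, Bool.or_eq_true, beq_iff_eq, decide_eq_true_eq]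
  exact ⟨hv, by omega⟩

/-- **A chain edge of `graph₂`** from its pattern and the absence of slots. [folklore] -/
theorem adj₂_chain {u v : ℕ} (hv : v < 5 * M φ)
    (h : (u % 5 = 0 ∧ v = u + 1) ∨ (u % 5 = 1 ∧ (v = u + 1 ∨ v = u + 2)) ∨ (u % 5 = 2 ∧ (v = u + 1 ∨ v = u + 2)) ∨
      (u % 5 = 3 ∧ v = u + 1) ∨ (u % 5 = 4 ∧ v = u + 1)) (hn : NotSlot φ u v) : (graph₂ φ).Adj u v :=
  adj₂_of_chain (chain_adj_of hv h) hn.1 hn.2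

/-- `r N + s < N²` and its quotient and remainder. [folklore] -/
theorem site_idx {r s : ℕ} (hr : r < N φ) (hs : s < N φ) :
    r * N φ + s < N φ * N φ ∧ (r * N φ + s) / N φ = r ∧ (r * N φ + s) % N φ = s := by
  refine ⟨?_, by rw [Nat.add_comm, Nat.add_mul_div_right _ _ (by omega), Nat.div_eq_of_lt hs, Nat.zero_add],
    by rw [Nat.add_comm, Nat.add_mul_mod_self_right, Nat.mod_eq_of_lt hs]⟩
  calc r * N φ + s < r * N φ + N φ := by omega
    _ = (r + 1) * N φ := by ring
    _ ≤ N φ * N φ := Nat.mul_le_mul_right _ hr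

/-- **An inner or port edge of the diamond ladder of site `(r, s)` is an edge of `graph₂`** unless it
is a hop edge. The template vertex `x` is numbered `dlBase + x` (`x < 24`), `a(Bl), q(Bl), a(Br),
p(Br)` (`x = 24, …, 27`). [folklore] -/
theorem adj₂_dl {r s : ℕ} (hr : r < N φ) (hs : s < N φ) {x y : Fin 28} (hxy : (x, y) ∈ DiamondLadder.edges)
    (hns : (dlNum φ (r * N φ + s) x, dlNum φ (r * N φ + s) y) ∉ SB₂ φ ∧ (dlNum φ (r * N φ + s) y, dlNum φ (r * N φ + s) x) ∉ SB₂ φ) :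
    (graph₂ φ).Adj (dlNum φ (r * N φ + s) x) (dlNum φ (r * N φ + s) y) := by
  obtain ⟨hlt, -, -⟩ := site_idx (φ := φ) hr hs
  have hn : r * N φ + s < n₁ φ := by unfold n₁; omega
  exact adj₂_of_placed₁ hn ((placed₁_adj_dl hlt).2 ⟨x, y, DiamondLadder.adj_of_mem hxy, rfl, rfl⟩) hns

/-- The numbering of the diamond ladder of site `(r, s)`, evaluated. [folklore] -/
theorem dlNum_eq {r s : ℕ} (hr : r < N φ) (hs : s < N φ) (x : Fin 28) :
    dlNum φ (r * N φ + s) x = if x.val < 24 then dlBase φ r s + x.val else if x.val = 24 then 5 * blIdx φ r s + 2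
      else if x.val = 25 then 5 * blIdx φ r s + 4 else if x.val = 26 then 5 * blIdx φ r (s + 1) + 2 else 5 * blIdx φ r (s + 1) + 1 := by
  obtain ⟨-, hd, hm⟩ := site_idx (φ := φ) hr hs
  unfold dlNum; rw [hd, hm, ← brIdx_eq]; rfl

/-- **An edge of the pin on dummy cell `d`** is an edge of `graph₂` (template vertices: the nodes at
`pinBase d, pinBase d + 1`, the rung at `pinBase d + 2`, the ports at `p, a` of the cell). [folklore] -/
theorem adj₂_pin {d : ℕ} (hd : d < 2 * N φ) {x y : RailV 1 2 1} (hxy : RailOR1.Γ.graph.Adj x y)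
    (hns : (railNum (K := 2) (pinBase φ d) (fun _ => slUL d) x, railNum (K := 2) (pinBase φ d) (fun _ => slUL d) y) ∉ SB₂ φ ∧
      (railNum (K := 2) (pinBase φ d) (fun _ => slUL d) y, railNum (K := 2) (pinBase φ d) (fun _ => slUL d) x) ∉ SB₂ φ) :
    (graph₂ φ).Adj (railNum (K := 2) (pinBase φ d) (fun _ => slUL d) x) (railNum (K := 2) (pinBase φ d) (fun _ => slUL d) y) := by
  have hn : N φ * N φ + d < n₁ φ := by unfold n₁; omega
  have h := (placed₁_adj_pin (φ := φ) (i := N φ * N φ + d) (by omega) (by omega) (a := railNum (K := 2) (pinBase φ d) (fun _ => slUL d) x)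
    (b := railNum (K := 2) (pinBase φ d) (fun _ => slUL d) y)).2
  rw [Nat.add_sub_cancel_left] at h
  exact adj₂_of_placed₁ hn (h ⟨x, y, hxy, rfl, rfl⟩) hns

/-- **An edge of the unit-clause gadget** is an edge of `graph₂`. [folklore] -/
theorem adj₂_cl1 {x y : RailV 1 2 1} (hxy : RailOR1.Γ.graph.Adj x y)
    (hns : (railNum (K := 2) (clause1Base φ) (fun _ => litSlot φ 0) x, railNum (K := 2) (clause1Base φ) (fun _ => litSlot φ 0) y) ∉ SB₂ φ ∧
      (railNum (K := 2) (clause1Base φ) (fun _ => litSlot φ 0) y, railNum (K := 2) (clause1Base φ) (fun _ => litSlot φ 0) x) ∉ SB₂ φ) :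
    (graph₂ φ).Adj (railNum (K := 2) (clause1Base φ) (fun _ => litSlot φ 0) x) (railNum (K := 2) (clause1Base φ) (fun _ => litSlot φ 0) y) := by
  have hn : N φ * N φ + 2 * N φ < n₁ φ := by unfold n₁; omega
  exact adj₂_of_placed₁ hn (placed₁_adj_cl1.2 ⟨x, y, hxy, rfl, rfl⟩) hns

/-- **An edge of the gadget of three-literal clause `t`** is an edge of `graph₂`. [folklore] -/
theorem adj₂_or3 {t : ℕ} (ht : t < T φ) {x y : RailV 3 6 9} (hxy : RailOR3.Γ.graph.Adj x y)
    (hns : (railNum (K := 6) (or3Base φ t) (fun r => litSlot φ (3 * t + 1 + r.val)) x,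
        railNum (K := 6) (or3Base φ t) (fun r => litSlot φ (3 * t + 1 + r.val)) y) ∉ SB₂ φ ∧
      (railNum (K := 6) (or3Base φ t) (fun r => litSlot φ (3 * t + 1 + r.val)) y,
        railNum (K := 6) (or3Base φ t) (fun r => litSlot φ (3 * t + 1 + r.val)) x) ∉ SB₂ φ) :
    (graph₂ φ).Adj (railNum (K := 6) (or3Base φ t) (fun r => litSlot φ (3 * t + 1 + r.val)) x)
      (railNum (K := 6) (or3Base φ t) (fun r => litSlot φ (3 * t + 1 + r.val)) y) := by
  have hn : N φ * N φ + 2 * N φ + 1 + t < n₁ φ := by unfold n₁; omega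
  have h := (placed₁_adj_or3 (φ := φ) (i := N φ * N φ + 2 * N φ + 1 + t) (by omega) hn
    (a := railNum (K := 6) (or3Base φ t) (fun r => litSlot φ (3 * t + 1 + r.val)) x)
    (b := railNum (K := 6) (or3Base φ t) (fun r => litSlot φ (3 * t + 1 + r.val)) y)).2
  rw [Nat.add_sub_cancel_left] at h
  exact adj₂_of_placed₁ hn (h ⟨x, y, hxy, rfl, rfl⟩) hns

/-- **An edge of hop ladder `h` of column `c` in row `r`** is an edge of `graph₂`. [folklore] -/
theorem adj₂_hop {c r h : ℕ} (hc : c < N φ) (hr : r < N φ) (hh : h < 5) {x y : RailV 2 4 4} (hxy : RailXOR.Γ.graph.Adj x y) :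
    (graph₂ φ).Adj (railNum (K := 4) (hopBase φ c r h) (ends₂ (hopSlots' φ c r h)) x)
      (railNum (K := 4) (hopBase φ c r h) (ends₂ (hopSlots' φ c r h)) y) := by
  obtain ⟨hsp, hlt⟩ := slotPair₂_hop hc hr hh
  refine adj₂_of_placed₂ hlt ((placed₂_adj hlt).2 ⟨x, y, hxy, ?_, ?_⟩) <;> rw [hsp] <;> rfl

/-- **An edge of the set ladder of column `c`** is an edge of `graph₂`. [folklore] -/
theorem adj₂_set {c : ℕ} (hc : c < N φ) {x y : RailV 2 4 4} (hxy : RailXOR.Γ.graph.Adj x y) :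
    (graph₂ φ).Adj (railNum (K := 4) (setBase φ c) (ends₂ (setSlots' φ c)) x) (railNum (K := 4) (setBase φ c) (ends₂ (setSlots' φ c)) y) := by
  have hlt : 5 * (N φ * N φ) + c < n₂ φ := by unfold n₂; omega
  have hsp : slotPair₂ φ (5 * (N φ * N φ) + c) = setSlots' φ c := by
    unfold slotPair₂; rw [if_neg (by omega), if_pos (by omega), Nat.add_sub_cancel_left]
  have hb : base2 φ + 12 * (5 * (N φ * N φ) + c) = setBase φ c := by unfold setBase; ring
  refine adj₂_of_placed₂ hlt ((placed₂_adj hlt).2 ⟨x, y, hxy, ?_, ?_⟩) <;> rw [hsp, hb]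

/-- **An edge of the clause link of column `c`** is an edge of `graph₂`. [folklore] -/
theorem adj₂_klink {c : ℕ} (hc : c < N φ) {x y : RailV 2 4 4} (hxy : RailXOR.Γ.graph.Adj x y) :
    (graph₂ φ).Adj (railNum (K := 4) (klinkBase φ c) (ends₂ (klinkSlots' φ c)) x)
      (railNum (K := 4) (klinkBase φ c) (ends₂ (klinkSlots' φ c)) y) := by
  have hlt : 5 * (N φ * N φ) + N φ + c < n₂ φ := by unfold n₂; omega
  have hsp : slotPair₂ φ (5 * (N φ * N φ) + N φ + c) = klinkSlots' φ c := by
    unfold slotPair₂; rw [if_neg (by omega), if_neg (by omega), Nat.add_sub_cancel_left]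
  have hb : base2 φ + 12 * (5 * (N φ * N φ) + N φ + c) = klinkBase φ c := by unfold klinkBase; ring
  refine adj₂_of_placed₂ hlt ((placed₂_adj hlt).2 ⟨x, y, hxy, ?_, ?_⟩) <;> rw [hsp, hb]

/-- The edges of the diamond ladder, by vertex numbers. [folklore] -/
def dlEdgesN : List (ℕ × ℕ) := DiamondLadder.edges.map fun e => (e.1.val, e.2.val)

/-- **An inner edge `x – y` of the diamond ladder of site `(r, s)`** (not a hop edge) is an edge of `graph₂`. [folklore] -/
theorem adj₂_dl_inner {r s : ℕ} (hr : r < N φ) (hs : s < N φ) {x y : ℕ} (hy : y < 24) (hxy : x < y)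
    (hmem : (x, y) ∈ dlEdgesN ∨ (y, x) ∈ dlEdgesN) (h : ∀ k < 4, ¬ (x = 8 + 4 * k ∧ (y = 9 + 4 * k ∨ y = 10 + 4 * k))) :
    (graph₂ φ).Adj (dlBase φ r s + x) (dlBase φ r s + y) := by
  have hns := not_SB₂_dl hr hs hxy hy h
  have key : ∀ {a b : ℕ}, (a, b) ∈ dlEdgesN → a < 24 → b < 24 → ∃ u v : Fin 28, DiamondLadder.graph.Adj u v ∧
      dlNum φ (r * N φ + s) u = dlBase φ r s + a ∧ dlNum φ (r * N φ + s) v = dlBase φ r s + b := by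
    intro a b hab ha hb
    obtain ⟨e, he, hab⟩ := List.mem_map.1 hab
    simp only [Prod.mk.injEq] at hab
    obtain ⟨rfl, rfl⟩ := hab
    exact ⟨e.1, e.2, DiamondLadder.adj_of_mem he, by rw [dlNum_eq hr hs, if_pos (by exact ha)], by rw [dlNum_eq hr hs, if_pos (by exact hb)]⟩
  obtain ⟨hlt, -, -⟩ := site_idx (φ := φ) hr hs
  have hn : r * N φ + s < n₁ φ := by unfold n₁; omega
  rcases hmem with hmem | hmem
  · obtain ⟨u, v, huv, hu, hv⟩ := key hmem (by omega) hy
    have := adj₂_of_placed₁ hn ((placed₁_adj_dl hlt).2 ⟨u, v, huv, rfl, rfl⟩) (by rw [hu, hv]; exact hns)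
    rwa [hu, hv] at this
  · obtain ⟨u, v, huv, hu, hv⟩ := key hmem hy (by omega)
    have := adj₂_of_placed₁ hn ((placed₁_adj_dl hlt).2 ⟨u, v, huv, rfl, rfl⟩) (by rw [hu, hv]; exact ⟨hns.2, hns.1⟩)
    rw [hu, hv] at this; exact this.symm

/-- **The port edges of the diamond ladder of site `(r, s)`**: `a(Bl) – v₀`, `q(Bl) – v₃`, `a(Br) – w₀`,
`p(Br) – w₃`. [folklore] -/
theorem adj₂_dl_ports {r s : ℕ} (hr : r < N φ) (hs : s < N φ) :
    (graph₂ φ).Adj (5 * blIdx φ r s + 2) (dlBase φ r s + 0) ∧ (graph₂ φ).Adj (5 * blIdx φ r s + 4) (dlBase φ r s + 3) ∧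
      (graph₂ φ).Adj (5 * blIdx φ r (s + 1) + 2) (dlBase φ r s + 4) ∧ (graph₂ φ).Adj (5 * blIdx φ r (s + 1) + 1) (dlBase φ r s + 7) := by
  have hb1 : 5 * blIdx φ r s + 4 < base1 φ := five_cell_lt_base1 φ (rowCell_lt_M hr (by omega))
  have hb2 : 5 * blIdx φ r (s + 1) + 4 < base1 φ := by
    have := five_cell_lt_base1 φ (rowCell_lt_M hr (k := 2 * s + 2) (by omega)); unfold blIdx; unfold rowCell at *; omega
  have hge : base1 φ ≤ dlBase φ r s := by unfold dlBase; omega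
  have e24 : dlNum φ (r * N φ + s) 24 = 5 * blIdx φ r s + 2 := by rw [dlNum_eq hr hs]; rfl
  have e25 : dlNum φ (r * N φ + s) 25 = 5 * blIdx φ r s + 4 := by rw [dlNum_eq hr hs]; rfl
  have e26 : dlNum φ (r * N φ + s) 26 = 5 * blIdx φ r (s + 1) + 2 := by rw [dlNum_eq hr hs]; rfl
  have e27 : dlNum φ (r * N φ + s) 27 = 5 * blIdx φ r (s + 1) + 1 := by rw [dlNum_eq hr hs]; rfl
  have e0 : dlNum φ (r * N φ + s) 0 = dlBase φ r s + 0 := by rw [dlNum_eq hr hs]; rfl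
  have e3 : dlNum φ (r * N φ + s) 3 = dlBase φ r s + 3 := by rw [dlNum_eq hr hs]; rfl
  have e4 : dlNum φ (r * N φ + s) 4 = dlBase φ r s + 4 := by rw [dlNum_eq hr hs]; rfl
  have e7 : dlNum φ (r * N φ + s) 7 = dlBase φ r s + 7 := by rw [dlNum_eq hr hs]; rfl
  refine ⟨?_, ?_, ?_, ?_⟩
  · have := adj₂_dl hr hs (x := 24) (y := 0) (by decide) (by rw [e24, e0]; exact not_SB₂_mixed (by omega) (by omega)); rwa [e24, e0] at this
  · have := adj₂_dl hr hs (x := 25) (y := 3) (by decide) (by rw [e25, e3]; exact not_SB₂_mixed (by omega) (by omega)); rwa [e25, e3] at this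
  · have := adj₂_dl hr hs (x := 26) (y := 4) (by decide) (by rw [e26, e4]; exact not_SB₂_mixed (by omega) (by omega)); rwa [e26, e4] at this
  · have := adj₂_dl hr hs (x := 27) (y := 7) (by decide) (by rw [e27, e7]; exact not_SB₂_mixed (by omega) (by omega)); rwa [e27, e7] at this

/-- **Edges at gadget vertices above the diamond-ladder blocks are not stage-2 slots** (the only
stage-2 slots between gadget vertices are hop edges, inside diamond ladders). [folklore] -/
theorem not_SB₂_high {a b : ℕ} (ha : base1 φ + 24 * (N φ * N φ) ≤ a) : (a, b) ∉ SB₂ φ ∧ (b, a) ∉ SB₂ φ := by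
  have key : ∀ e ∈ SB₂ φ, base1 φ ≤ e.1 → e.1 < base1 φ + 24 * (N φ * N φ) ∧ e.2 < base1 φ + 24 * (N φ * N φ) := by
    intro e he h1
    obtain ⟨r, j, k, hr, hj, hk, h⟩ := SB₂_hop he (by unfold IsHop; exact h1)
    have := dlBase_add_lt_base2 (φ := φ) hr hj
    have hlt : r * N φ + j + 1 ≤ N φ * N φ := by
      calc r * N φ + j + 1 ≤ r * N φ + N φ := by omega
        _ = (r + 1) * N φ := by ring
        _ ≤ N φ * N φ := Nat.mul_le_mul_right _ hr
    rcases h with rfl | rfl <;> [unfold hopUL; unfold hopLL] <;> unfold dlBase <;> simp only <;> omega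
  refine ⟨fun h => ?_, fun h => ?_⟩
  · have := (key _ h (by simp only; omega)).1; simp only at this; omega
  · by_cases hb : base1 φ ≤ b
    · have := (key _ h (by simp only; exact hb)).2; simp only at this; omega
    · have := (SB₂_not_mixed h).1 (by simp only; omega); simp only at this; omega

/-- **The expected key pairs of a dummy-pair tile are edges of `graph₂`.** Numbering: `(0, d) ↦ 5 (2c) + d`,
`(1, 0) ↦ 5 · Bl(0, 0)`, `(2, d) ↦ pinBase (2c) + d`, `(3, d) ↦ base2 + 60 c N + d`, `(4, d) ↦ setBase c + d`. [folklore] -/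
theorem pinBase_succ (c : ℕ) : pinBase φ (2 * c + 1) = pinBase φ (2 * c) + 3 := by unfold pinBase; omega

/-! ### Elimination rules: the edges of the templates -/

/-- **The edges of a rail gadget**: consecutive rail nodes, rung halves, port edges. [folklore] -/
theorem RailGadget.adj_cases {k K m : ℕ} (Γ : RailGadget k K m) {x y : RailV k K m} (h : Γ.graph.Adj x y) :
    ∃ u v, ((x = u ∧ y = v) ∨ (x = v ∧ y = u)) ∧
      ((∃ r : Fin k, ∃ t t' : Fin K, u = .node (r, t) ∧ v = .node (r, t') ∧ t.val + 1 = t'.val) ∨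
        (∃ ρ, u = .mid ρ ∧ (v = .node (Γ.fst ρ) ∨ v = .node (Γ.snd ρ))) ∨
        (∃ r : Fin k, ∃ t : Fin K, u = .port r true ∧ v = .node (r, t) ∧ t.val = 0) ∨
        (∃ r : Fin k, ∃ t : Fin K, u = .port r false ∧ v = .node (r, t) ∧ t.val + 1 = K)) := by
  have key : ∀ {u v}, Γ.relB u v = true →
      ((∃ r : Fin k, ∃ t t' : Fin K, u = .node (r, t) ∧ v = .node (r, t') ∧ t.val + 1 = t'.val) ∨
        (∃ ρ, u = .mid ρ ∧ (v = .node (Γ.fst ρ) ∨ v = .node (Γ.snd ρ))) ∨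
        (∃ r : Fin k, ∃ t : Fin K, u = .port r true ∧ v = .node (r, t) ∧ t.val = 0) ∨
        (∃ r : Fin k, ∃ t : Fin K, u = .port r false ∧ v = .node (r, t) ∧ t.val + 1 = K)) := by
    intro u v h
    cases u with
    | node a =>
      cases v with
      | node b =>
        simp only [RailGadget.relB, Bool.and_eq_true, beq_iff_eq] at h
        exact Or.inl ⟨a.1, a.2, b.2, rfl, by rw [h.1], h.2⟩
      | mid ρ => simp [RailGadget.relB] at h
      | port r b => simp [RailGadget.relB] at h
    | mid ρ =>
      cases v with
      | node b =>
        simp only [RailGadget.relB, Bool.or_eq_true, beq_iff_eq] at h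
        exact Or.inr (Or.inl ⟨ρ, rfl, by rcases h with h | h <;> [exact Or.inl (by rw [h]); exact Or.inr (by rw [h])]⟩)
      | mid ρ' => simp [RailGadget.relB] at h
      | port r b => simp [RailGadget.relB] at h
    | port r b =>
      cases v with
      | node x =>
        cases b
        · simp only [RailGadget.relB, Bool.and_eq_true, beq_iff_eq] at h
          exact Or.inr (Or.inr (Or.inr ⟨r, x.2, rfl, by rw [← h.1], h.2⟩))
        · simp only [RailGadget.relB, Bool.and_eq_true, beq_iff_eq] at h
          exact Or.inr (Or.inr (Or.inl ⟨r, x.2, rfl, by rw [← h.1], h.2⟩))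
      | mid ρ => cases b <;> simp [RailGadget.relB] at h
      | port r' b' => cases b <;> simp [RailGadget.relB] at h
  rw [RailGadget.graph] at h
  rcases h.2 with h' | h'
  · exact ⟨x, y, Or.inl ⟨rfl, rfl⟩, key h'⟩
  · exact ⟨y, x, Or.inr ⟨rfl, rfl⟩, key h'⟩

/-- **The edges of the diamond ladder are the listed ones** (by `decide`). [folklore] -/
theorem DiamondLadder.mem_edges_of_adj : ∀ x y : Fin 28, DiamondLadder.graph.Adj x y →
    (x.val, y.val) ∈ dlEdgesN ∨ (y.val, x.val) ∈ dlEdgesN := by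
  unfold dlEdgesN
  simp only [DiamondLadder.graph_adj]
  decide

end LOTReduction

/-! ## Degrees (formerly `HamiltonianLOTDegree.lean`)

# The gadget graph of the `#3SAT → #HamPath` reduction has maximum degree three

A generic degree bound for gadget substitution — substituting gadgets of inner degree at most `d`
(one port edge per port) into a base graph of degree at most `d` keeps the degree at most `d` —
and its application to the two substitution stages of `HamiltonianLOTCount.lean`: the diamond
chain, the diamond ladders, pins and clause gadgets, and the rail (XOR) gadgets all have degree at
most three (templates by `decide`), hence so does `graph₂ φ`. Used to bound the degrees of the grid
drawing (`GridSAWLOTDrawing*.lean`).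

## References

* M. Liśkiewicz, M. Ogihara, S. Toda, TCS 304 (2003) 129–156, §4 (Theorem 7: the graph has
  degree at most three, so that it can be drawn on the grid).
-/

open Finset Literature.Computability.Complexity

/-! ### A generic degree bound for gadget substitution -/

section generic

variable {α : Type*} [DecidableEq α]

/-- **Neighbourhoods of size at most `d`**: every vertex has a set of at most `d` vertices containing
all its neighbours (a degree bound that needs no local finiteness). [folklore] -/
def NbrsLe (G : _root_.SimpleGraph α) (d : ℕ) : Prop :=
  ∀ a, ∃ s : Finset α, s.card ≤ d ∧ ∀ b, G.Adj a b → b ∈ s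

namespace GadgetFamily

variable {M : _root_.SimpleGraph α} {V : Finset α} {𝒢 : GadgetFamily α} {n d : ℕ}

/-- **Gadget substitution does not increase degrees**: if the base graph has neighbourhoods of size
at most `d` inside `V` and every gadget vertex has at most `d` gadget neighbours, then after
substituting a valid family every vertex has at most `d` neighbours (a base vertex loses one base
edge for each slot at it and gains at most one port edge per gadget having a slot at it).
[folklore] -/
theorem Valid.nbrsLe_graphUpTo (hv : Valid M V 𝒢 n)
    (hM : ∀ a ∈ V, ∃ s : Finset α, s.card ≤ d ∧ ∀ b, M.Adj a b → b ∈ V → b ∈ s)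
    (hX : ∀ i < n, ∀ a ∈ 𝒢.VX i, ∃ s : Finset α, s.card ≤ d ∧ ∀ b, (𝒢.GX i).Adj a b → b ∈ s) :
    NbrsLe (graphUpTo M V 𝒢 n) d := by
  classical
  intro a
  by_cases haV : a ∈ V
  · obtain ⟨sM, hcard, hsM⟩ := hM a haV
    -- the gadgets with a slot at `a`, and the other ends of those slots
    set I : Finset ℕ := (range n).filter fun i => a ∈ ports (𝒢.S i) with hI
    have other : ∀ i ∈ I, ∃ b ∈ sM, slotOf (𝒢.S i) a b := by
      intro i hi
      rw [hI, mem_filter, mem_range] at hi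
      obtain ⟨e, he, hae⟩ := mem_ports_iff.1 hi.2
      obtain ⟨h1, h2, hadj⟩ := hv.slot_adj i hi.1 e he
      rcases hae with rfl | rfl
      · exact ⟨e.2, hsM _ hadj h2, Or.inl (by rw [Prod.mk.eta]; exact he)⟩
      · exact ⟨e.1, hsM _ hadj.symm h1, Or.inr (by rw [Prod.mk.eta]; exact he)⟩
    haveI : Nonempty α := ⟨a⟩
    choose! oth hoth using other
    have hinj : Set.InjOn oth ↑I := by
      intro i hi j hj hij
      by_contra hne
      have hi' := hi; have hj' := hj
      rw [Finset.mem_coe, hI, mem_filter, mem_range] at hi' hj'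
      have hsi := (hoth i hi).2
      have hsj := (hoth j hj).2
      rw [hij] at hsi
      -- the slot `{a, oth j}` of gadget `i` is also a slot of gadget `j`
      rcases hsi with hsi | hsi
      · exact hv.slot_across i hi'.1 j hj'.1 hne _ hsi hsj
      · exact hv.slot_across i hi'.1 j hj'.1 hne _ hsi (slotOf_comm.1 hsj)
    -- the port neighbour of `a` in gadget `i` (if any)
    have pn : ∀ i : ℕ, ∃ x : α, ∀ b, i < n → (𝒢.GX i).Adj a b → b = x := by
      intro i
      by_cases h : ∃ b, i < n ∧ (𝒢.GX i).Adj a b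
      · obtain ⟨b, hi, hb⟩ := h
        refine ⟨b, fun b' _ hb' => ?_⟩
        have hap : a ∈ ports (𝒢.S i) := by
          rcases (hv.gadget_adj i hi a b hb).2.1 with h | h
          · exact absurd (Finset.disjoint_left.1 (hv.V_disjoint i hi) haV) (not_not.2 h)
          · exact h
        exact hv.port_unique i hi a hap _ _ hb' hb
      · exact ⟨a, fun b hi hb => absurd ⟨b, hi, hb⟩ h⟩
    choose pnb hpnb using pn
    refine ⟨(sM.filter fun b => ∀ i < n, ¬ slotOf (𝒢.S i) a b) ∪ I.image pnb, ?_, ?_⟩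
    · calc ((sM.filter fun b => ∀ i < n, ¬ slotOf (𝒢.S i) a b) ∪ I.image pnb).card
          ≤ (sM.filter fun b => ∀ i < n, ¬ slotOf (𝒢.S i) a b).card + (I.image pnb).card := card_union_le _ _
        _ ≤ (sM.filter fun b => ∀ i < n, ¬ slotOf (𝒢.S i) a b).card + I.card := Nat.add_le_add_left card_image_le _
        _ ≤ (sM.filter fun b => ∀ i < n, ¬ slotOf (𝒢.S i) a b).card + (sM.filter fun b => ¬ ∀ i < n, ¬ slotOf (𝒢.S i) a b).card := by
            refine Nat.add_le_add_left ?_ _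
            refine Finset.card_le_card_of_injOn oth (fun i hi => ?_) hinj
            rw [Finset.mem_coe] at hi
            rw [Finset.mem_coe, mem_filter]
            have hi' := hi; rw [hI, mem_filter, mem_range] at hi'
            exact ⟨(hoth i hi).1, fun h => h i hi'.1 (hoth i hi).2⟩
        _ = sM.card := card_filter_add_card_filter_not _
        _ ≤ d := hcard
    · intro b hab
      rcases hab with ⟨hadj, -, hbV, hns⟩ | ⟨i, hi, hadj⟩
      · exact mem_union_left _ (mem_filter.2 ⟨hsM b hadj hbV, hns⟩)
      · refine mem_union_right _ (mem_image.2 ⟨i, ?_, (hpnb i b hi hadj).symm⟩)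
        rw [hI, mem_filter, mem_range]
        refine ⟨hi, ?_⟩
        rcases (hv.gadget_adj i hi a b hadj).2.1 with h | h
        · exact absurd (Finset.disjoint_left.1 (hv.V_disjoint i hi) haV) (not_not.2 h)
        · exact h
  · by_cases haX : ∃ i < n, a ∈ 𝒢.VX i
    · obtain ⟨i, hi, hai⟩ := haX
      obtain ⟨s, hcard, hs⟩ := hX i hi a hai
      refine ⟨s, hcard, fun b hab => ?_⟩
      rcases hab with ⟨-, haV', -⟩ | ⟨j, hj, hadj⟩
      · exact absurd haV' haV
      · have hij : j = i := by
          by_contra hne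
          rcases (hv.gadget_adj j hj a b hadj).2.1 with h | h
          · exact Finset.disjoint_left.1 (hv.VX_disjoint j hj i hi hne) h hai
          · exact haV (hv.ports_subset hj h)
        subst hij
        exact hs b hadj
    · refine ⟨∅, by simp, fun b hab => ?_⟩
      rcases hab with ⟨-, haV', -⟩ | ⟨j, hj, hadj⟩
      · exact absurd haV' haV
      · rcases (hv.gadget_adj j hj a b hadj).2.1 with h | h
        · exact absurd ⟨j, hj, h⟩ haX
        · exact absurd (hv.ports_subset hj h) haV

end GadgetFamily

omit [DecidableEq α] in
/-- **Mapped graphs keep template neighbourhoods**: if every vertex of `G` has at most `d`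
neighbours then so has every vertex of `G.map f` in the range of `f`. [folklore] -/
theorem nbrs_map_le {β : Type*} [DecidableEq β] [Fintype α] {G : _root_.SimpleGraph α} [DecidableRel G.Adj] (f : α ↪ β) {d : ℕ}
    (hG : ∀ v, (univ.filter fun w => G.Adj v w).card ≤ d) (v : α) :
    ∃ s : Finset β, s.card ≤ d ∧ ∀ b, (G.map f).Adj (f v) b → b ∈ s := by
  refine ⟨(univ.filter fun w => G.Adj v w).map f, by rw [card_map]; exact hG v, fun b hb => ?_⟩
  rw [_root_.SimpleGraph.map_adj] at hb
  obtain ⟨v', w, hadj, hv', rfl⟩ := hb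
  have := f.injective hv'; subst this
  exact mem_map.2 ⟨w, mem_filter.2 ⟨mem_univ _, hadj⟩, rfl⟩

end generic

/-! ### The templates have degree at most three (by `decide`) -/

/-- The XOR-gadget has degree at most three. [folklore] -/
theorem RailXOR.deg_le : ∀ v : RailV 2 4 4, (univ.filter fun w => RailXOR.Γ.graph.Adj v w).card ≤ 3 := by decide

/-- The one-input OR-gadget has degree at most three. [folklore] -/
theorem RailOR1.deg_le : ∀ v : RailV 1 2 1, (univ.filter fun w => RailOR1.Γ.graph.Adj v w).card ≤ 3 := by decide

/-- The three-input OR-gadget has degree at most three. [folklore] -/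
theorem RailOR3.deg_le : ∀ v : RailV 3 6 9, (univ.filter fun w => RailOR3.Γ.graph.Adj v w).card ≤ 3 := by decide

/-- The diamond ladder has degree at most three. [folklore] -/
theorem DiamondLadder.deg_le : ∀ v : Fin 28, (univ.filter fun w => DiamondLadder.graph.Adj v w).card ≤ 3 := by decide

/-- **Inner vertices of a placed rail gadget have at most three neighbours.** [folklore] -/
theorem RailPlacement.nbrs_le (P : RailPlacement) (hΓ : ∀ v : RailV P.k P.K P.m, (univ.filter fun w => P.Γ.graph.Adj v w).card ≤ 3)
    {a : ℕ} (ha : a ∈ P.VX) : ∃ s : Finset ℕ, s.card ≤ 3 ∧ ∀ b, P.GX.Adj a b → b ∈ s := by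
  obtain ⟨v, -, rfl⟩ := Finset.mem_map.1 ha
  exact nbrs_map_le P.emb hΓ v

/-- **Inner vertices of a placed diamond ladder have at most three neighbours.** [folklore] -/
theorem DLPlacement.nbrs_le (P : DLPlacement) {a : ℕ} (ha : a ∈ P.VX) : ∃ s : Finset ℕ, s.card ≤ 3 ∧ ∀ b, P.GX.Adj a b → b ∈ s := by
  obtain ⟨v, -, rfl⟩ := Finset.mem_map.1 ha
  exact nbrs_map_le P.emb DiamondLadder.deg_le v

namespace LOTReduction

variable {φ : CNF ℕ}

/-! ### The two stages -/

/-- **Inner vertices of the stage-1 gadgets have at most three neighbours.** [folklore] -/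
theorem placed₁_nbrs_le {i : ℕ} (hi : i < n₁ φ) {a : ℕ} (ha : a ∈ (placed₁ φ i).VX) :
    ∃ s : Finset ℕ, s.card ≤ 3 ∧ ∀ b, (placed₁ φ i).GX.Adj a b → b ∈ s := by
  revert ha
  unfold placed₁
  split_ifs with h₁ h₂ h₃
  · exact fun ha => DLPlacement.nbrs_le _ ha
  · exact fun ha => RailPlacement.nbrs_le _ RailOR1.deg_le ha
  · exact fun ha => RailPlacement.nbrs_le _ RailOR1.deg_le ha
  · exact fun ha => RailPlacement.nbrs_le _ RailOR3.deg_le ha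

/-- **Inner vertices of the stage-2 gadgets have at most three neighbours.** [folklore] -/
theorem placed₂_nbrs_le {i : ℕ} (hi : i < n₂ φ) {a : ℕ} (ha : a ∈ (placed₂ φ i).VX) :
    ∃ s : Finset ℕ, s.card ≤ 3 ∧ ∀ b, (placed₂ φ i).GX.Adj a b → b ∈ s := by
  revert ha
  unfold placed₂
  rw [dif_pos hi]
  exact fun ha => RailPlacement.nbrs_le _ RailXOR.deg_le ha

/-- **The diamond chain has degree at most three**: the neighbours of `u` are among `u-2, u-1, u+1,
u+2`, three of them according to `u mod 5`. [folklore] -/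
theorem chain_nbrs_le (Mc : ℕ) : ∀ a ∈ chainV Mc, ∃ s : Finset ℕ, s.card ≤ 3 ∧ ∀ b, (chainG Mc).Adj a b → b ∈ chainV Mc → b ∈ s := by
  intro a _
  refine ⟨if a % 5 = 0 then {a - 1, a + 1} else if a % 5 = 1 ∨ a % 5 = 2 then {a - 1, a + 1, a + 2} else {a - 2, a - 1, a + 1}, ?_,
    fun b hab _ => ?_⟩
  · split_ifs
    · exact card_le_two.trans (by norm_num)
    · exact card_le_three
    · exact card_le_three
  · rw [chainG_adj] at hab
    obtain ⟨hne, h⟩ := hab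
    unfold chainRelB at h
    simp only [Bool.and_eq_true, Bool.or_eq_true, beq_iff_eq, decide_eq_true_eq] at h
    split_ifs with h0 h12 <;> simp only [mem_insert, mem_singleton] <;> omega

/-- **The gadget graph `graph₂ φ` has degree at most three.** [cite: LiskiewiczOgiharaToda2003, §4 (Theorem 7)] -/
theorem graph₂_nbrsLe : NbrsLe (graph₂ φ) 3 := by
  have h1 : NbrsLe (graph₁ φ) 3 :=
    (valid₁ (φ := φ)).nbrsLe_graphUpTo (chain_nbrs_le (M φ)) (fun i hi a ha => placed₁_nbrs_le hi ha)
  refine (valid₂ (φ := φ)).nbrsLe_graphUpTo (fun a _ => ?_) (fun i hi a ha => placed₂_nbrs_le hi ha)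
  obtain ⟨s, hs, h⟩ := h1 a
  exact ⟨s, hs, fun b hb _ => h b hb⟩

end LOTReduction

/-! ## The vertex set is an initial segment (formerly `HamiltonianLOTVerts.lean`)

# Gadgets for `#3SAT → #HamPath`: the vertex set of the gadget graph is an initial segment

`verts₂ φ` (`HamiltonianLOTCount.lean`: the chain `0, …, 5M - 1`, the stage-1 blocks tiling
`[base1, base2)`, the stage-2 blocks tiling `[base2, totalV)`) is exactly `{0, …, totalV - 1}`,
and both ends `0`, `5M - 1` lie in it (for the transfer of the Hamiltonian path count to the numbered
grid drawing, `GridSAWCountingGridHamPathHardnessProofs.lean`).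

## References

* M. Liśkiewicz, M. Ogihara, S. Toda, TCS 304 (2003) 129–156, §3.
-/

namespace LOTReduction

open Finset Literature.Computability.Complexity

variable {φ : CNF ℕ}

/-- The stage-2 blocks end at `totalV`. [folklore] -/
theorem base2_add : base2 φ + 12 * n₂ φ = totalV φ := by unfold totalV n₂; ring

/-- `base1 = 5M`. [folklore] -/
theorem base1_eq : base1 φ = 5 * M φ := rfl

/-- **Every vertex of the gadget graph is below `totalV`.** [folklore] -/
theorem lt_totalV_of_mem_verts₂ {v : ℕ} (hv : v ∈ verts₂ φ) : v < totalV φ := by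
  have hb2 : base2 φ ≤ totalV φ := by unfold totalV; omega
  have hb1 : base1 φ ≤ base2 φ := by unfold base2 clause1Base; omega
  rcases GadgetFamily.mem_vertsUpTo_iff.1 hv with hv | ⟨i, hi, hv⟩
  · rcases GadgetFamily.mem_vertsUpTo_iff.1 hv with hv | ⟨i, hi, hv⟩
    · have := Finset.mem_range.1 hv; rw [← base1_eq] at this; omega
    · have h := ((placed₁ φ i).mem_VX_iff v).1 hv
      rw [placed₁_lo, placed₁_size] at h
      have := lo₁_add_size_le_base2 hi; omega
  · have h := ((placed₂ φ i).mem_VX_iff v).1 hv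
    rw [(placed₂_lo hi).1, (placed₂_lo hi).2] at h
    have := base2_add (φ := φ); omega

/-- **Every number below `totalV` is a vertex of the gadget graph.** [folklore] -/
theorem mem_verts₂_of_lt {v : ℕ} (hv : v < totalV φ) : v ∈ verts₂ φ := by
  rw [verts₂, GadgetFamily.mem_vertsUpTo_iff, verts₁, GadgetFamily.mem_vertsUpTo_iff]
  by_cases h0 : v < base1 φ
  · exact Or.inl (Or.inl (Finset.mem_range.2 (by rw [base1_eq] at h0; omega)))
  by_cases h2 : v < base2 φ
  · -- a stage-1 block: diamond ladders, pins, the unit clause, the clause gadgets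
    refine Or.inl (Or.inr ?_)
    have key : ∀ i, i < n₁ φ → lo₁ φ i ≤ v → v < lo₁ φ i + size₁ φ i → ∃ i < n₁ φ, v ∈ (fam₁ φ).VX i := fun i hi h1 h2 =>
      ⟨i, hi, ((placed₁ φ i).mem_VX_iff v).2 (by rw [placed₁_lo, placed₁_size]; exact ⟨h1, h2⟩)⟩
    by_cases hdl : v < base1 φ + 24 * (N φ * N φ)
    · have hi : (v - base1 φ) / 24 < N φ * N φ := by omega
      refine key ((v - base1 φ) / 24) (by unfold n₁; omega) ?_ ?_ <;> simp only [lo₁, size₁, if_pos hi] <;> omega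
    by_cases hpin : v < clause1Base φ
    · have hi : N φ * N φ + (v - (base1 φ + 24 * (N φ * N φ))) / 3 < N φ * N φ + 2 * N φ := by unfold clause1Base at hpin; omega
      have n1 : ¬ N φ * N φ + (v - (base1 φ + 24 * (N φ * N φ))) / 3 < N φ * N φ := by omega
      refine key (N φ * N φ + (v - (base1 φ + 24 * (N φ * N φ))) / 3) (by unfold n₁; omega) ?_ ?_ <;>
        simp only [lo₁, size₁, if_neg n1, if_pos hi] <;> unfold pinBase <;> omega
    by_cases hcl : v < clause1Base φ + 3
    · have n1 : ¬ N φ * N φ + 2 * N φ < N φ * N φ := by omega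
      have n2 : ¬ N φ * N φ + 2 * N φ < N φ * N φ + 2 * N φ := by omega
      refine key (N φ * N φ + 2 * N φ) (by unfold n₁; omega) ?_ ?_ <;> simp only [lo₁, size₁, if_neg n1, if_neg n2, if_true] <;> omega
    · have hT : (v - (clause1Base φ + 3)) / 27 < T φ := by unfold base2 at h2; omega
      have hi : N φ * N φ + 2 * N φ + 1 + (v - (clause1Base φ + 3)) / 27 < n₁ φ := by unfold n₁; omega
      have n1 : ¬ N φ * N φ + 2 * N φ + 1 + (v - (clause1Base φ + 3)) / 27 < N φ * N φ := by omega
      have n2 : ¬ N φ * N φ + 2 * N φ + 1 + (v - (clause1Base φ + 3)) / 27 < N φ * N φ + 2 * N φ := by omega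
      have n3 : ¬ N φ * N φ + 2 * N φ + 1 + (v - (clause1Base φ + 3)) / 27 = N φ * N φ + 2 * N φ := by omega
      refine key _ hi ?_ ?_ <;> simp only [lo₁, size₁, if_neg n1, if_neg n2, if_neg n3, if_pos hi] <;> unfold or3Base <;> omega
  · -- a stage-2 block
    have h12 := base2_add (φ := φ)
    have hi : (v - base2 φ) / 12 < n₂ φ := by omega
    refine Or.inr ⟨_, hi, ((placed₂ φ _).mem_VX_iff v).2 ?_⟩
    rw [(placed₂_lo hi).1, (placed₂_lo hi).2]; omega

/-- **The vertex set of the gadget graph is `{0, …, totalV - 1}`.** [folklore] -/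
theorem verts₂_eq_range : verts₂ φ = Finset.range (totalV φ) := by
  ext v
  rw [Finset.mem_range]
  exact ⟨lt_totalV_of_mem_verts₂, mem_verts₂_of_lt⟩

/-- **The two ends lie below `totalV`.** [folklore] -/
theorem ends_lt_totalV : 0 < totalV φ ∧ 5 * M φ - 1 < totalV φ := by
  have := M_pos (φ := φ)
  have : 5 * M φ ≤ totalV φ := by rw [← base1_eq]; unfold totalV base2 clause1Base; omega
  omega

end LOTReduction

end Literature.Combinatorics.SimpleGraph
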